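import Summits.HodgeConjecture.CorCM.MultiFieldWeilFresh
import Summits.HodgeConjecture.CorCM.CMWeightDistribution
import Summits.HodgeConjecture.CorCM.CMWeightPullbackSubproduct
import HarnessLib

/-!
# COR-CM — MULTI-FIELD WEIL, part 6a: restriction of a weight to a sub-family of slots, the family `δfam`, sign ⟹ eigenvalue, and the PARTIALLY
# MERGED base slots `mergeG` / `partSlots` / `partEmb` (bookkeeping for the single-slot Weil parts)

Cell `pub-hodgecm2` (COR-CM), seat b30 gen 28 (2026-08-23); count-neutral own lane MULTI-FIELD WEIL ENGINE; sequel of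
`CorCM/MultiFieldWeilFresh.lean`, consumed by `CorCM/MultiFieldWeilParts.lean`.  Theorems plus bookkeeping definitions (`δfam`, `mergeG`, `partSlots`,
`partEmb`); no named fact, no `sorry`.
* §0 `exists_map_sigma_eq_fin` (a weight is the image of its restriction to an injective sub-family of slots containing its slots), `δfam`
  (`(δ; i_1 δ, …, i_r δ)`), `apply_eq_of_signG` (a point of sign `b` has eigenvalue `±i√d` on `δfam`);
* §1 `mergeG r c : Fin (r+1+c) → Fin (r+1)` (`r+1` original slots followed by `c` marked CURVE slots), `partSlots c m = (m+1; 0, …, 0)`,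
  `partEmb r c m` (the slot of `B_m`, then the marked slots), `mergeG ∘ partEmb = partSlots`.
HONEST FRAMING: nothing about the Hodge conjecture is concluded here; `HC_CM` is not asserted.
[cite: Deligne1982HodgeCycles, §5 (c)] [cite: Milne2020HodgeClassesAV, 1.2 (a) and Thm. 1]

## References
* [Deligne1982HodgeCycles] P. Deligne, LNM 900 (1982), §5 (c).  [Milne2020HodgeClassesAV] J. S. Milne, arXiv:2010.08857, 1.2 (a), Thm. 1.
-/

noncomputable section

open CategoryTheory CategoryTheory.Limits NumberField

namespace Summit.HodgeConjecture.CorCM.MultiFieldWeil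

open Literature.AlgebraicGeometry Literature.AlgebraicGeometry.Motives Literature.AlgebraicGeometry.HodgeTheory
open Literature.AlgebraicGeometry.ComplexMultiplication (IsCMTypeRealisation)
open Literature.AlgebraicGeometry.Pohlmann1968
open Literature.AlgebraicTopology.SingularHomology
open Literature.NumberTheory.ComplexMultiplication
open Summit.HodgeConjecture.CorCM.Census.MultiFieldWeil
open Summit.HodgeConjecture.CorCM.CMWeights (weightClassesAlg_comp_le_algebraicClasses_of_injOn weightClassesAlg_map_le_algebraicClasses
  sigma_map_injective)
open Summit.HodgeConjecture.CorCM.PairWeights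

open scoped Classical Pointwise

/-! ## §0 Restriction to a sub-family of slots; sign ⟹ eigenvalue -/

section Sub

/-- A weight is the image of its restriction to an injective sub-family of slots containing all its slots (any base family). [folklore] -/
theorem exists_map_sigma_eq_fin {n' m : ℕ} {K : Fin n' → Type} [∀ i, Field (K i)] [∀ i, NumberField (K i)] (eₘ : Fin m → Fin n') (heₘ : Function.Injective eₘ)
    (T : Finset ((i : Fin n') × (K i →+* ℂ))) (hT : ∀ x ∈ T, x.1 ∈ Set.range eₘ) :
    ∃ S'' : Finset ((j : Fin m) × (K (eₘ j) →+* ℂ)),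
      S''.map ⟨_, sigma_map_injective (K := K) eₘ heₘ⟩ = T ∧ ∀ y, y ∈ S'' ↔ (⟨eₘ y.1, y.2⟩ : (i : Fin n') × (K i →+* ℂ)) ∈ T := by
  refine ⟨Finset.univ.filter fun y => (⟨eₘ y.1, y.2⟩ : (i : Fin n') × (K i →+* ℂ)) ∈ T, ?_, fun y => by simp⟩
  ext x
  rw [Finset.mem_map]
  constructor
  · rintro ⟨y, hy, rfl⟩
    exact (Finset.mem_filter.1 hy).2
  · intro hx
    obtain ⟨j, hj⟩ := hT x hx
    obtain ⟨j', s⟩ := x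
    dsimp only at hj
    subst hj
    exact ⟨⟨j, s⟩, Finset.mem_filter.2 ⟨Finset.mem_univ _, hx⟩, rfl⟩

end Sub

section Eigen

variable {I : Type} {r : ℕ} {Kf : I → Type} [∀ i, Field (Kf i)] {i₀ : I} {is : Fin r → I} {n : Fin r → ℕ}
  {e : ∀ m : Fin r, (Kf (is m) →+* ℂ) ≃ Fin (n m) × Bool} {τ : Kf i₀ →+* ℂ} {im : ∀ m : Fin r, Kf i₀ →+* Kf (is m)}
  (hk : ∀ σ : Kf i₀ →+* ℂ, σ = τ ∨ σ = ComplexEmbedding.conjugate τ)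
  (he_sign : ∀ (m : Fin r) (s : Kf (is m) →+* ℂ), (e m s).2 = true ↔ s.comp (im m) = τ)

/-- **The family `(δ; i_1 δ, …, i_r δ)`** of the element `δ ∈ 𝓞_k` pushed into every slot. [folklore] -/
def δfam (im : ∀ m : Fin r, Kf i₀ →+* Kf (is m)) (δ : 𝓞 (Kf i₀)) : ∀ j : Fin (r + 1), 𝓞 (Kf (mfSlots i₀ is j)) :=
  Fin.cons δ fun m => RingOfIntegers.mapRingHom (im m) δ

/-- `δfam` on the curve slot. [folklore] -/
@[simp] theorem δfam_zero (δ : 𝓞 (Kf i₀)) : δfam im δ 0 = δ := rfl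

/-- `δfam` on the field slots. [folklore] -/
@[simp] theorem δfam_succ (δ : 𝓞 (Kf i₀)) (m : Fin r) : δfam im δ m.succ = RingOfIntegers.mapRingHom (im m) δ := rfl

variable {δ : 𝓞 (Kf i₀)} {d : ℕ} (hτ : τ (δ : Kf i₀) = Complex.I * (Real.sqrt d : ℂ))

include hk he_sign hτ in
/-- **Sign ⟹ eigenvalue**: a point of the index set of `Y = ⨁ A` of sign `b` (over `inl b` or `inr ⟨m, (a, b)⟩`) has eigenvalue `+i√d`
(`b = true`) resp. `−i√d` (`b = false`) on the family `δfam`. [cite: Deligne1982HodgeCycles, §5 (c)] -/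
theorem apply_eq_of_signG (x : (j : Fin (r + 1)) × (Kf (mfSlots i₀ is j) →+* ℂ)) (b : Bool)
    (hx : toPtG e τ x = Sum.inl b ∨ ∃ (m : Fin r) (a : Fin (n m)), toPtG e τ x = Sum.inr ⟨m, (a, b)⟩) :
    x.2 ((δfam im δ x.1 : 𝓞 (Kf (mfSlots i₀ is x.1))) : Kf (mfSlots i₀ is x.1)) =
      if b then Complex.I * (Real.sqrt d : ℂ) else -(Complex.I * (Real.sqrt d : ℂ)) := by
  have hconjτ : ComplexEmbedding.conjugate τ (δ : Kf i₀) = -(Complex.I * (Real.sqrt d : ℂ)) := by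
    rw [ComplexEmbedding.conjugate_coe_eq, hτ, map_mul, Complex.conj_I, Complex.conj_ofReal, neg_mul]
  rcases sigma_casesG x with ⟨σ, rfl⟩ | ⟨m, s, rfl⟩
  · -- the curve slot: `σ = τ_b`
    have hσ : decide (σ = τ) = b := by
      rcases hx with h | ⟨m, a, h⟩
      · rw [toPtG_zero, Sum.inl.injEq] at h; exact h
      · rw [toPtG_zero] at h; exact absurd h Sum.inl_ne_inr
    show σ (δ : Kf i₀) = _
    cases b
    · rw [if_neg Bool.false_ne_true, (hk σ).resolve_left (of_decide_eq_false hσ)]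
      exact hconjτ
    · rw [if_pos rfl, of_decide_eq_true hσ]
      exact hτ
  · -- a field slot: `(e m s).2 = b`
    have hs : (e m s).2 = b := by
      rcases hx with h | ⟨m', a, h⟩
      · rw [toPtG_succ] at h; exact absurd h Sum.inr_ne_inl
      · rw [toPtG_succ, Sum.inr.injEq] at h
        obtain ⟨rfl, h2⟩ := (Sigma.mk.inj_iff.1 h)
        exact (Prod.mk.inj (eq_of_heq h2)).2
    show s ((RingOfIntegers.mapRingHom (im m) δ : 𝓞 (Kf (is m))) : Kf (is m)) = _
    have hmap : ((RingOfIntegers.mapRingHom (im m) δ : 𝓞 (Kf (is m))) : Kf (is m)) = im m (δ : Kf i₀) := rfl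
    rw [hmap]
    change (s.comp (im m)) (δ : Kf i₀) = _
    cases b
    · have h' : s.comp (im m) = ComplexEmbedding.conjugate τ := by
        rcases hk (s.comp (im m)) with h | h
        · have := (he_sign m s).2 h; rw [hs] at this; exact absurd this Bool.false_ne_true
        · exact h
      rw [if_neg Bool.false_ne_true, h']
      exact hconjτ
    · rw [if_pos rfl, (he_sign m s).1 hs]
      exact hτ

end Eigen

/-! ## §1 The partially merged base family -/

section Merge

variable {r : ℕ}

/-- **The merged base slots**: `r + 1` original slots followed by `c` marked CURVE slots. [folklore] -/
def mergeG (r c : ℕ) : Fin (r + 1 + c) → Fin (r + 1) := Fin.append id fun _ : Fin c => 0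

/-- Original slots are kept. [folklore] -/
@[simp] theorem mergeG_castAdd (c : ℕ) (j : Fin (r + 1)) : mergeG r c (Fin.castAdd c j) = j := by
  simp [mergeG]

/-- Marked slots are curve slots. [folklore] -/
@[simp] theorem mergeG_natAdd (c : ℕ) (i : Fin c) : mergeG r c (Fin.natAdd (r + 1) i) = 0 := by
  simp [mergeG]

/-- **The slots of the single-slot part**: `(m+1; 0, …, 0)` — `B_m` and `c` curves. [folklore] -/
def partSlots (c : ℕ) (m : Fin r) : Fin (c + 1) → Fin (r + 1) := Fin.cons m.succ fun _ : Fin c => 0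

/-- **The sub-family of merged slots carrying the part**: the slot of `B_m`, then the marked slots. [folklore] -/
def partEmb (r c : ℕ) (m : Fin r) : Fin (c + 1) → Fin (r + 1 + c) := Fin.cons (Fin.castAdd c m.succ) fun i : Fin c => Fin.natAdd (r + 1) i

/-- `partEmb` at `0`. [folklore] -/
@[simp] theorem partEmb_zero (c : ℕ) (m : Fin r) : partEmb r c m 0 = Fin.castAdd c m.succ := rfl

/-- `partEmb` at `i+1`. [folklore] -/
@[simp] theorem partEmb_succ (c : ℕ) (m : Fin r) (i : Fin c) : partEmb r c m i.succ = Fin.natAdd (r + 1) i := rfl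

/-- `partEmb` is injective. [folklore] -/
theorem partEmb_injective (c : ℕ) (m : Fin r) : Function.Injective (partEmb r c m) := by
  intro i i' h
  refine Fin.cases ?_ (fun l => ?_) i h <;> refine Fin.cases ?_ (fun l' => ?_) i' <;> intro h
  · rfl
  · rw [partEmb_zero, partEmb_succ] at h
    have h' := congrArg Fin.val h
    simp only [Fin.val_castAdd, Fin.val_natAdd] at h'
    have := (Fin.succ m).isLt
    omega
  · rw [partEmb_zero, partEmb_succ] at h
    have h' := congrArg Fin.val h
    simp only [Fin.val_castAdd, Fin.val_natAdd] at h'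
    have := (Fin.succ m).isLt
    omega
  · rw [partEmb_succ, partEmb_succ] at h
    rw [Fin.natAdd_inj] at h
    rw [h]

/-- `mergeG ∘ partEmb = partSlots`. [folklore] -/
theorem mergeG_partEmb (c : ℕ) (m : Fin r) : (fun i => mergeG r c (partEmb r c m i)) = partSlots c m := by
  funext i
  refine Fin.cases ?_ (fun l => ?_) i
  · rw [partEmb_zero, mergeG_castAdd]; rfl
  · rw [partEmb_succ, mergeG_natAdd]; rfl

end Merge

end Summit.HodgeConjecture.CorCM.MultiFieldWeil

end
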